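import Summits.Parity.GeneralizedHardyLittlewood.Theorems.PrimeLevelFamEdgeMomentsBeyondDiagonalDiagRemP2TailIdentity
import Summits.Parity.GeneralizedHardyLittlewood.Theorems.BeyondDiagonalBeatsQuarter.CornerSums
import HarnessLib

/-!
# Route `PrimeLevelFamEdge`, crux K_A `MomentsBeyondDiagonal` (stmt-Parity-20007), line «petersson_layers» v4, stub `stub_diag`:
# **(P2TAIL): `Σ_{k ≤ y} a_n(k)P₂(k) = c_n + O(D(n)(1+log y)⁻¹²)`, `c_n = −2Σ_m h_n(m)`** (L5b, the last link)

The ONE new analytic input of the order-`(2,2)` remainder estimate of `stub_diag` (plan: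
`Cruxes/MomentsBeyondDiagonal/Lines/petersson_layers_stub_diag_g12_R02_R22.md`): the `P₂`-decorated Selberg coefficients
`b_n = a_n·P₂` (`a_n = copTauW n`) have CONVERGENT partial sums with a power-of-log rate, so that `b̃_n = b_n − c_nδ₁` has small
tails and the both-sided monomial `P₂(k₁)P₂(k₂)·r₀₀` of the `(2,2)` remainder weight is handled by the existing two-sequence Abel
lemma (δ-subtraction). Assembly of `…DiagRemP2TailIdentity.sum_copTauW_primeSq_eq` with `N(z) + 1 = O((1+log z)⁻¹²)`
(`…DiagRemP2Hyperbola`), `MM(z) = O((1+log z)⁻¹²)` (`…Corner.abs_moebiusSqSum_le`), `P̃₂(m) ≤ log²m ≤ 2¹⁰m^{1/16}`, and the tree's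
`Σ_m|h_n(m)|m^{1/8} ≤ C·D(n)` (`…KernelFormXSq.tsum_abs_hloc_mul_rpow_le`).

* `factorization_sum_logSq_le` — `P̃₂(m) ≤ log²m`;
* `inv_log_pow_le_rpow_sixteenth_mul` — `1/(1+log(y/m))¹² ≤ m^{1/16}(2¹²/(1+log y)¹² + y^{−1/32})`;
* `abs_sum_copTauW_primeSq_sub_le_of` — **(P2TAIL)** (from the Goldston–Yıldırım fact, PROVED in the tree, carried as in L3/L4).

Def-free; theorems only. Helper `--supports stmt-Parity-20007`; closes nothing; K_A, K_B and the Parity summit are NOT proved;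
nothing about Landau–Siegel zeros.

## References
* E. Kowalski, P. Michel, J. VanderKam, J. reine angew. Math. 526 (2000), Prop. 5.1 p. 18.
  [cite: KowalskiMichelVanderKam2000, Prop. 5.1 — derivation (P₂-twisted Selberg coefficients)]
-/

noncomputable section

open Finset Real
open scoped ArithmeticFunction.Moebius

namespace Summit.Parity.GeneralizedHardyLittlewood.Theorems.MomentsBeyondDiagonal.DiagCorner

open Literature.NumberTheory.Sieve (goldstonYildirim_lemma21_j0)
open Summit.Parity.GeneralizedHardyLittlewood.Theorems.BeyondDiagonalBeatsQuarter.KernelFormXSq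
  (copTauW hloc divWeight divWeight_nonneg tsum_abs_hloc_mul_rpow_le summable_abs_hloc_mul_rpow summable_hloc
   summable_abs_hloc abs_hloc_le_mul_rpow)
open Summit.Parity.GeneralizedHardyLittlewood.Theorems.BeyondDiagonalBeatsQuarter.Corner
  (abs_moebiusSqSum_le inv_log_pow_le_rpow_mul rpow_neg_sixteenth_le_inv_log_pow rpow_neg_le_div_log_pow)

/-- `P̃₂(m) = Σ_p v_p(m)log²p ≤ log²m`. [folklore] -/
theorem factorization_sum_logSq_le (m : ℕ) :
    (m.factorization.sum fun p k ↦ (k : ℝ) * Real.log p ^ 2) ≤ Real.log m ^ 2 := by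
  rcases Nat.eq_zero_or_pos m with rfl | hm
  · simp
  have hm0 : m ≠ 0 := hm.ne'
  -- `log m = Σ_p v_p(m) log p`
  have hlog : Real.log m = ∑ p ∈ m.factorization.support, (m.factorization p : ℝ) * Real.log p := by
    have h := Nat.prod_factorization_pow_eq_self hm0
    conv_lhs => rw [← h]
    rw [Finsupp.prod, Nat.cast_prod, Real.log_prod]
    · refine Finset.sum_congr rfl fun p hp ↦ ?_
      rw [Nat.cast_pow, Real.log_pow]
    · intro p hp
      have hp' : p.Prime := Nat.prime_of_mem_primeFactors (by rwa [Nat.support_factorization] at hp)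
      exact_mod_cast pow_ne_zero _ hp'.ne_zero
  have hterm : ∀ p ∈ m.factorization.support, 0 ≤ (m.factorization p : ℝ) * Real.log p ∧ Real.log p ≤ Real.log m := by
    intro p hp
    rw [Nat.support_factorization] at hp
    have hp' : p.Prime := Nat.prime_of_mem_primeFactors hp
    have h2 : (2 : ℝ) ≤ p := by exact_mod_cast hp'.two_le
    refine ⟨mul_nonneg (Nat.cast_nonneg _) (Real.log_nonneg (by linarith)), ?_⟩
    exact Real.log_le_log (by linarith) (by exact_mod_cast Nat.le_of_dvd hm (Nat.dvd_of_mem_primeFactors hp))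
  have hlog0 : 0 ≤ Real.log m := Real.log_nonneg (by exact_mod_cast hm)
  calc (m.factorization.sum fun p k ↦ (k : ℝ) * Real.log p ^ 2)
      = ∑ p ∈ m.factorization.support, (m.factorization p : ℝ) * Real.log p * Real.log p := by
        rw [Finsupp.sum]; refine Finset.sum_congr rfl fun p _ ↦ by ring
    _ ≤ ∑ p ∈ m.factorization.support, (m.factorization p : ℝ) * Real.log p * Real.log m :=
        Finset.sum_le_sum fun p hp ↦ mul_le_mul_of_nonneg_left (hterm p hp).2 (hterm p hp).1
    _ = Real.log m * Real.log m := by rw [← Finset.sum_mul, ← hlog]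
    _ = Real.log m ^ 2 := by ring

/-- For `1 ≤ m ≤ y`: `1/(1 + log(y/m))¹² ≤ m^{1/16}·(2¹²/(1 + log y)¹² + y^{−1/32})` (split at `m = √y`; the `1/16`-variant of
`…Corner.inv_log_pow_le_rpow_mul`). [folklore] -/
theorem inv_log_pow_le_rpow_sixteenth_mul {y : ℝ} (hy : 1 ≤ y) {m : ℕ} (hm1 : 1 ≤ m) (hmy : (m : ℝ) ≤ y) :
    1 / (1 + Real.log (y / m)) ^ 12 ≤
      (m : ℝ) ^ (1 / 16 : ℝ) * ((2 : ℝ) ^ 12 / (1 + Real.log y) ^ 12 + y ^ (-(1 / 32 : ℝ))) := by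
  have hy0 : 0 < y := by linarith
  have hm0 : (0 : ℝ) < m := by exact_mod_cast hm1
  have hm1' : (1 : ℝ) ≤ m := by exact_mod_cast hm1
  have hym : 1 ≤ y / m := by rw [le_div_iff₀ hm0]; linarith
  have hL : 0 ≤ Real.log y := Real.log_nonneg hy
  have hLm : 0 ≤ Real.log (y / m) := Real.log_nonneg hym
  have hm8 : 1 ≤ (m : ℝ) ^ (1 / 16 : ℝ) := Real.one_le_rpow hm1' (by norm_num)
  have hA : 0 ≤ (2 : ℝ) ^ 12 / (1 + Real.log y) ^ 12 := by positivity
  have hB : 0 ≤ y ^ (-(1 / 32 : ℝ)) := by positivity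
  rcases le_or_gt ((m : ℝ) ^ 2) y with hcase | hcase
  · have hlog : Real.log y ≤ 2 * Real.log (y / m) := by
      rw [Real.log_div hy0.ne' hm0.ne']
      have : 2 * Real.log m ≤ Real.log y := by
        have h2 : Real.log ((m : ℝ) ^ 2) = 2 * Real.log m := by
          rw [Real.log_pow]; norm_num
        rw [← h2]; exact Real.log_le_log (by positivity) hcase
      linarith
    have h1 : 1 + Real.log y ≤ 2 * (1 + Real.log (y / m)) := by linarith
    have h2 : 1 / (1 + Real.log (y / m)) ^ 12 ≤ (2 : ℝ) ^ 12 / (1 + Real.log y) ^ 12 := by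
      rw [div_le_div_iff₀ (by positivity) (by positivity), one_mul, ← mul_pow]
      exact pow_le_pow_left₀ (by positivity) h1 12
    calc 1 / (1 + Real.log (y / m)) ^ 12 ≤ (2 : ℝ) ^ 12 / (1 + Real.log y) ^ 12 := h2
      _ ≤ 1 * ((2 : ℝ) ^ 12 / (1 + Real.log y) ^ 12 + y ^ (-(1 / 32 : ℝ))) := by linarith
      _ ≤ (m : ℝ) ^ (1 / 16 : ℝ) * ((2 : ℝ) ^ 12 / (1 + Real.log y) ^ 12 + y ^ (-(1 / 32 : ℝ))) :=
          mul_le_mul_of_nonneg_right hm8 (by positivity)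
  · have h1 : 1 / (1 + Real.log (y / m)) ^ 12 ≤ 1 := by
      rw [div_le_one (by positivity)]
      exact one_le_pow₀ (by linarith)
    have h2 : 1 ≤ (m : ℝ) ^ (1 / 16 : ℝ) * y ^ (-(1 / 32 : ℝ)) := by
      have hy16 : y ^ (-(1 / 32 : ℝ)) = (y ^ (1 / 32 : ℝ))⁻¹ := Real.rpow_neg hy0.le _
      have hypos : 0 < y ^ (1 / 32 : ℝ) := by positivity
      rw [hy16, ← div_eq_mul_inv, le_div_iff₀ hypos, one_mul]
      have : y ^ (1 / 32 : ℝ) ≤ ((m : ℝ) ^ 2) ^ (1 / 32 : ℝ) :=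
        Real.rpow_le_rpow hy0.le hcase.le (by norm_num)
      refine this.trans (le_of_eq ?_)
      rw [← Real.rpow_natCast, ← Real.rpow_mul hm0.le]
      norm_num
    calc 1 / (1 + Real.log (y / m)) ^ 12 ≤ 1 := h1
      _ ≤ (m : ℝ) ^ (1 / 16 : ℝ) * y ^ (-(1 / 32 : ℝ)) := h2
      _ ≤ (m : ℝ) ^ (1 / 16 : ℝ) * ((2 : ℝ) ^ 12 / (1 + Real.log y) ^ 12 + y ^ (-(1 / 32 : ℝ))) := by
          apply mul_le_mul_of_nonneg_left _ (by positivity); linarith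

set_option maxHeartbeats 1600000 in
/-- **(P2TAIL).** There is `C ≥ 0` such that for every `n ≥ 1` there is `c_n` (`= −2Σ_m h_n(m)`, `|c_n| ≤ C·D(n)`) with
`|Σ_{k ≤ y} a_n(k)P₂(k) − c_n| ≤ C·D(n)/(1 + log y)¹²` for all `y ≥ 1` (from the Goldston–Yıldırım fact, PROVED in the tree).
[cite: KowalskiMichelVanderKam2000, Prop. 5.1 — derivation (P₂-twisted Selberg coefficients)] -/
theorem abs_sum_copTauW_primeSq_sub_le_of (hGY : goldstonYildirim_lemma21_j0) :
    ∃ C : ℝ, 0 ≤ C ∧ ∀ n : ℕ, n ≠ 0 → ∃ c : ℝ, |c| ≤ C * divWeight n ∧ ∀ y : ℝ, 1 ≤ y →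
      |(∑ k ∈ Icc 1 ⌊y⌋₊, copTauW n k * ∑ p ∈ k.primeFactors, Real.log p ^ 2) - c| ≤
        C * divWeight n / (1 + Real.log y) ^ 12 := by
  obtain ⟨K₄, hK₄⟩ := sum_moebius_primeSq_hyperbola_asymp_of hGY 12
  obtain ⟨C_M, hC_M, hM⟩ := abs_moebiusSqSum_le
  obtain ⟨C_h, hC_h, hH⟩ := tsum_abs_hloc_mul_rpow_le
  obtain ⟨C₁₆, hC₁₆, h16⟩ := rpow_neg_sixteenth_le_inv_log_pow
  obtain ⟨C₃₂, hC₃₂, h32⟩ := rpow_neg_le_div_log_pow (show (0 : ℝ) < 1 / 32 by norm_num) 12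
  obtain ⟨C₈, hC₈, h8⟩ := rpow_neg_le_div_log_pow (show (0 : ℝ) < 1 / 8 by norm_num) 12
  have hK₄0 : 0 ≤ K₄ := by
    have h := hK₄ 1 le_rfl
    rw [Real.log_one, add_zero, one_pow, div_one] at h
    exact (abs_nonneg _).trans h
  set C : ℝ := 2 * K₄ * C_h * ((2 : ℝ) ^ 12 + C₁₆) + 2 ^ 10 * C_M * C_h * ((2 : ℝ) ^ 12 + C₃₂) + 2 * C_h * C₈ + 2 * C_h
    with hCdef
  refine ⟨C, by positivity, fun n hn ↦ ?_⟩
  set D : ℝ := divWeight n with hDdef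
  have hD0 : 0 ≤ D := divWeight_nonneg n
  have hHn : ∑' m : ℕ, |hloc n m| * (m : ℝ) ^ (1 / 8 : ℝ) ≤ C_h * D := by
    have := hH n hn; simpa [hDdef, divWeight] using this
  have hsw := summable_abs_hloc_mul_rpow hn
  have hsa := summable_abs_hloc hn
  have hs := summable_hloc hn
  -- the constant `c_n = -2 Σ_m h_n(m)` and its bound
  have habs_tsum : |∑' m : ℕ, hloc n m| ≤ C_h * D := by
    calc |∑' m : ℕ, hloc n m| ≤ ∑' m : ℕ, |hloc n m| := by
          have := norm_tsum_le_tsum_norm (f := fun m : ℕ ↦ hloc n m) (by simpa [Real.norm_eq_abs] using hsa)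
          simpa [Real.norm_eq_abs] using this
      _ ≤ ∑' m : ℕ, |hloc n m| * (m : ℝ) ^ (1 / 8 : ℝ) :=
          hsa.tsum_le_tsum (fun m ↦ abs_hloc_le_mul_rpow n m) hsw
      _ ≤ C_h * D := hHn
  refine ⟨-2 * ∑' m : ℕ, hloc n m, ?_, fun y hy ↦ ?_⟩
  · rw [abs_mul, abs_neg, abs_two]
    calc 2 * |∑' m : ℕ, hloc n m| ≤ 2 * (C_h * D) := by linarith [habs_tsum]
      _ = (2 * C_h) * D := by ring
      _ ≤ C * D := by
          apply mul_le_mul_of_nonneg_right _ hD0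
          rw [hCdef]
          have : 0 ≤ 2 * K₄ * C_h * ((2 : ℝ) ^ 12 + C₁₆) + 2 ^ 10 * C_M * C_h * ((2 : ℝ) ^ 12 + C₃₂) + 2 * C_h * C₈ := by
            positivity
          linarith
  -- the main estimate
  have hy0 : 0 < y := by linarith
  set N : ℕ := ⌊y⌋₊ with hNdef
  set L : ℝ := Real.log y with hLdef
  have hL : 0 ≤ L := Real.log_nonneg hy
  have hN1 : 1 ≤ N := Nat.le_floor (by simpa using hy)
  rw [sum_copTauW_primeSq_eq n N]
  -- abbreviations
  set Nf : ℕ → ℝ := fun m ↦ ∑ d ∈ Icc 1 (N / m), ∑ e ∈ Icc 1 (N / m / d),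
      (ArithmeticFunction.moebius d : ℝ) / d * (∑ p ∈ d.primeFactors, Real.log p ^ 2) *
        ((ArithmeticFunction.moebius e : ℝ) / e) with hNf
  set Mf : ℕ → ℝ := fun m ↦ ∑ d ∈ Ioc 0 (N / m), ∑ e ∈ Ioc 0 (N / m / d),
      (ArithmeticFunction.moebius d : ℝ) / d * ((ArithmeticFunction.moebius e : ℝ) / e) with hMf
  set Pt : ℕ → ℝ := fun m ↦ m.factorization.sum fun p k ↦ (k : ℝ) * Real.log p ^ 2 with hPt
  have hsum_eq : ∑ m ∈ Icc 1 N, hloc n m * (2 * Nf m + Pt m * Mf m) =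
      2 * ∑ m ∈ Icc 1 N, hloc n m * (Nf m + 1) + ∑ m ∈ Icc 1 N, hloc n m * (Pt m * Mf m) -
        2 * ∑ m ∈ Icc 1 N, hloc n m := by
    rw [Finset.mul_sum, Finset.mul_sum, ← Finset.sum_add_distrib, ← Finset.sum_sub_distrib]
    refine Finset.sum_congr rfl fun m _ ↦ by ring
  -- the tail `Σ' h - Σ_{m ≤ N} h`
  have htail_eq : ∑ m ∈ Icc 1 N, hloc n m = ∑' m : ℕ, hloc n m - ∑' m : ℕ, hloc n (m + (N + 1)) := by
    have h1 : ∑ m ∈ Icc 1 N, hloc n m = ∑ m ∈ Finset.range (N + 1), hloc n m := by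
      have hI : Finset.range (N + 1) = insert 0 (Icc 1 N) := by
        ext m; simp only [Finset.mem_range, Finset.mem_insert, Finset.mem_Icc]; omega
      rw [hI, Finset.sum_insert (by simp), ArithmeticFunction.map_zero, zero_add]
    rw [h1, ← hs.sum_add_tsum_nat_add (N + 1)]
    ring
  rw [hsum_eq, htail_eq]
  have hring : 2 * ∑ m ∈ Icc 1 N, hloc n m * (Nf m + 1) + ∑ m ∈ Icc 1 N, hloc n m * (Pt m * Mf m) -
      2 * (∑' m : ℕ, hloc n m - ∑' m : ℕ, hloc n (m + (N + 1))) - -2 * ∑' m : ℕ, hloc n m =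
      2 * ∑ m ∈ Icc 1 N, hloc n m * (Nf m + 1) + ∑ m ∈ Icc 1 N, hloc n m * (Pt m * Mf m) +
        2 * ∑' m : ℕ, hloc n (m + (N + 1)) := by ring
  rw [hring]
  -- facts about `m ∈ Icc 1 N`
  have hmem : ∀ m ∈ Icc 1 N, 1 ≤ m ∧ (0 : ℝ) < m ∧ (m : ℝ) ≤ y ∧ 1 ≤ y / m ∧ ⌊y / m⌋₊ = N / m := by
    intro m hm
    have hm' := Finset.mem_Icc.1 hm
    have hm0 : (0 : ℝ) < m := by exact_mod_cast hm'.1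
    have hmy : (m : ℝ) ≤ y := le_trans (by exact_mod_cast hm'.2) (Nat.floor_le hy0.le)
    exact ⟨hm'.1, hm0, hmy, by rw [le_div_iff₀ hm0]; linarith, by rw [hNdef]; exact Nat.floor_div_natCast y m⟩
  have hfin : ∑ m ∈ Icc 1 N, |hloc n m| * (m : ℝ) ^ (1 / 8 : ℝ) ≤ C_h * D :=
    le_trans (hsw.sum_le_tsum _ (fun m _ ↦ by positivity)) hHn
  ------------------------------------------------------------
  -- (a) the `N + 1` part
  ------------------------------------------------------------
  have ha : |∑ m ∈ Icc 1 N, hloc n m * (Nf m + 1)| ≤ K₄ * C_h * ((2 : ℝ) ^ 12 + C₁₆) * D / (1 + L) ^ 12 := by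
    have hterm : ∀ m ∈ Icc 1 N, |hloc n m * (Nf m + 1)| ≤
        (|hloc n m| * (m : ℝ) ^ (1 / 8 : ℝ)) * (K₄ * ((2 : ℝ) ^ 12 / (1 + L) ^ 12 + y ^ (-(1 / 16 : ℝ)))) := by
      intro m hm
      obtain ⟨hm1, hm0, hmy, hym, hfl⟩ := hmem m hm
      have h1 := hK₄ (y / m) hym
      rw [hfl] at h1
      have h2 := inv_log_pow_le_rpow_mul hy hm1 hmy
      rw [abs_mul]
      calc |hloc n m| * |Nf m + 1| ≤ |hloc n m| * (K₄ / (1 + Real.log (y / m)) ^ 12) :=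
            mul_le_mul_of_nonneg_left h1 (abs_nonneg _)
        _ = |hloc n m| * K₄ * (1 / (1 + Real.log (y / m)) ^ 12) := by ring
        _ ≤ |hloc n m| * K₄ * ((m : ℝ) ^ (1 / 8 : ℝ) * ((2 : ℝ) ^ 12 / (1 + L) ^ 12 + y ^ (-(1 / 16 : ℝ)))) :=
            mul_le_mul_of_nonneg_left h2 (by positivity)
        _ = _ := by ring
    calc _ ≤ ∑ m ∈ Icc 1 N, (|hloc n m| * (m : ℝ) ^ (1 / 8 : ℝ)) *
          (K₄ * ((2 : ℝ) ^ 12 / (1 + L) ^ 12 + y ^ (-(1 / 16 : ℝ)))) :=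
          (Finset.abs_sum_le_sum_abs _ _).trans (Finset.sum_le_sum hterm)
      _ = (∑ m ∈ Icc 1 N, |hloc n m| * (m : ℝ) ^ (1 / 8 : ℝ)) *
          (K₄ * ((2 : ℝ) ^ 12 / (1 + L) ^ 12 + y ^ (-(1 / 16 : ℝ)))) := by rw [Finset.sum_mul]
      _ ≤ (C_h * D) * (K₄ * ((2 : ℝ) ^ 12 / (1 + L) ^ 12 + C₁₆ / (1 + L) ^ 12)) := by
          refine mul_le_mul hfin ?_ (by positivity) (by positivity)
          exact mul_le_mul_of_nonneg_left (by linarith [h16 y hy]) hK₄0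
      _ = K₄ * C_h * ((2 : ℝ) ^ 12 + C₁₆) * D / (1 + L) ^ 12 := by field_simp
  ------------------------------------------------------------
  -- (b) the `P̃₂·MM` part
  ------------------------------------------------------------
  have hb : |∑ m ∈ Icc 1 N, hloc n m * (Pt m * Mf m)| ≤ 2 ^ 10 * C_M * C_h * ((2 : ℝ) ^ 12 + C₃₂) * D / (1 + L) ^ 12 := by
    have hterm : ∀ m ∈ Icc 1 N, |hloc n m * (Pt m * Mf m)| ≤
        (|hloc n m| * (m : ℝ) ^ (1 / 8 : ℝ)) * (2 ^ 10 * C_M * ((2 : ℝ) ^ 12 / (1 + L) ^ 12 + y ^ (-(1 / 32 : ℝ)))) := by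
      intro m hm
      obtain ⟨hm1, hm0, hmy, hym, hfl⟩ := hmem m hm
      have hMm := hM (y / m) hym
      rw [hfl] at hMm
      have h2 := inv_log_pow_le_rpow_sixteenth_mul hy hm1 hmy
      -- `P̃₂(m) ≤ log²m ≤ 2¹⁰ m^{1/16}`
      have hlogm : Real.log m ≤ (m : ℝ) ^ (1 / 32 : ℝ) / (1 / 32) := Real.log_natCast_le_rpow_div m (by norm_num)
      have hlogm0 : 0 ≤ Real.log m := Real.log_nonneg (by exact_mod_cast hm1)
      have hPtle : Pt m ≤ 2 ^ 10 * (m : ℝ) ^ (1 / 16 : ℝ) := by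
        refine (factorization_sum_logSq_le m).trans ?_
        have h32 : (m : ℝ) ^ (1 / 32 : ℝ) * (m : ℝ) ^ (1 / 32 : ℝ) = (m : ℝ) ^ (1 / 16 : ℝ) := by
          rw [← Real.rpow_add hm0]; norm_num
        calc Real.log m ^ 2 ≤ ((m : ℝ) ^ (1 / 32 : ℝ) / (1 / 32)) ^ 2 := pow_le_pow_left₀ hlogm0 hlogm 2
          _ = 2 ^ 10 * ((m : ℝ) ^ (1 / 32 : ℝ) * (m : ℝ) ^ (1 / 32 : ℝ)) := by ring
          _ = 2 ^ 10 * (m : ℝ) ^ (1 / 16 : ℝ) := by rw [h32]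
      have hPt0 : 0 ≤ Pt m := by
        simp only [hPt, Finsupp.sum]
        exact Finset.sum_nonneg fun p _ ↦ by positivity
      have h18 : (m : ℝ) ^ (1 / 16 : ℝ) * (m : ℝ) ^ (1 / 16 : ℝ) = (m : ℝ) ^ (1 / 8 : ℝ) := by
        rw [← Real.rpow_add hm0]; norm_num
      rw [abs_mul, abs_mul, abs_of_nonneg hPt0]
      calc |hloc n m| * (Pt m * |Mf m|) ≤ |hloc n m| * ((2 ^ 10 * (m : ℝ) ^ (1 / 16 : ℝ)) * (C_M / (1 + Real.log (y / m)) ^ 12)) :=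
            mul_le_mul_of_nonneg_left (mul_le_mul hPtle hMm (abs_nonneg _) (by positivity)) (abs_nonneg _)
        _ = |hloc n m| * (2 ^ 10 * C_M) * (m : ℝ) ^ (1 / 16 : ℝ) * (1 / (1 + Real.log (y / m)) ^ 12) := by ring
        _ ≤ |hloc n m| * (2 ^ 10 * C_M) * (m : ℝ) ^ (1 / 16 : ℝ) *
            ((m : ℝ) ^ (1 / 16 : ℝ) * ((2 : ℝ) ^ 12 / (1 + L) ^ 12 + y ^ (-(1 / 32 : ℝ)))) :=
            mul_le_mul_of_nonneg_left h2 (by positivity)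
        _ = (|hloc n m| * ((m : ℝ) ^ (1 / 16 : ℝ) * (m : ℝ) ^ (1 / 16 : ℝ))) *
            (2 ^ 10 * C_M * ((2 : ℝ) ^ 12 / (1 + L) ^ 12 + y ^ (-(1 / 32 : ℝ)))) := by ring
        _ = _ := by rw [h18]
    calc _ ≤ ∑ m ∈ Icc 1 N, (|hloc n m| * (m : ℝ) ^ (1 / 8 : ℝ)) *
          (2 ^ 10 * C_M * ((2 : ℝ) ^ 12 / (1 + L) ^ 12 + y ^ (-(1 / 32 : ℝ)))) :=
          (Finset.abs_sum_le_sum_abs _ _).trans (Finset.sum_le_sum hterm)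
      _ = (∑ m ∈ Icc 1 N, |hloc n m| * (m : ℝ) ^ (1 / 8 : ℝ)) *
          (2 ^ 10 * C_M * ((2 : ℝ) ^ 12 / (1 + L) ^ 12 + y ^ (-(1 / 32 : ℝ)))) := by rw [Finset.sum_mul]
      _ ≤ (C_h * D) * (2 ^ 10 * C_M * ((2 : ℝ) ^ 12 / (1 + L) ^ 12 + C₃₂ / (1 + L) ^ 12)) := by
          refine mul_le_mul hfin ?_ (by positivity) (by positivity)
          exact mul_le_mul_of_nonneg_left (by linarith [h32 y hy]) (by positivity)
      _ = 2 ^ 10 * C_M * C_h * ((2 : ℝ) ^ 12 + C₃₂) * D / (1 + L) ^ 12 := by field_simp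
  ------------------------------------------------------------
  -- (c) the tail `Σ_{m > N} h_n(m)`
  ------------------------------------------------------------
  have hc : |∑' m : ℕ, hloc n (m + (N + 1))| ≤ C_h * C₈ * D / (1 + L) ^ 12 := by
    have hsa' : Summable fun m : ℕ ↦ |hloc n (m + (N + 1))| :=
      (summable_nat_add_iff (f := fun m : ℕ ↦ |hloc n m|) (N + 1)).2 hsa
    have hsw' : Summable fun m : ℕ ↦ |hloc n (m + (N + 1))| * ((m + (N + 1) : ℕ) : ℝ) ^ (1 / 8 : ℝ) :=
      (summable_nat_add_iff (f := fun m : ℕ ↦ |hloc n m| * (m : ℝ) ^ (1 / 8 : ℝ)) (N + 1)).2 hsw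
    have hy8 : 0 < y ^ (1 / 8 : ℝ) := by positivity
    -- shifted tail of the weighted series
    have htail : ∑' m : ℕ, |hloc n (m + (N + 1))| * ((m + (N + 1) : ℕ) : ℝ) ^ (1 / 8 : ℝ) ≤ C_h * D := by
      have h := hsw.sum_add_tsum_nat_add (N + 1)
      have hnonneg : 0 ≤ ∑ i ∈ Finset.range (N + 1), |hloc n i| * (i : ℝ) ^ (1 / 8 : ℝ) :=
        Finset.sum_nonneg fun i _ ↦ by positivity
      linarith
    -- pointwise: `|h(m')| ≤ |h(m')| m'^{1/8} · y^{-1/8}` for `m' > N ≥ y - 1`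
    have hpt : ∀ m : ℕ, |hloc n (m + (N + 1))| ≤
        (|hloc n (m + (N + 1))| * ((m + (N + 1) : ℕ) : ℝ) ^ (1 / 8 : ℝ)) * y ^ (-(1 / 8 : ℝ)) := by
      intro m
      have hmy : y ≤ ((m + (N + 1) : ℕ) : ℝ) := by
        have : y < (N : ℝ) + 1 := Nat.lt_floor_add_one y
        push_cast; linarith
      have hpow : y ^ (1 / 8 : ℝ) ≤ ((m + (N + 1) : ℕ) : ℝ) ^ (1 / 8 : ℝ) := Real.rpow_le_rpow hy0.le hmy (by norm_num)
      have hh0 : 0 ≤ |hloc n (m + (N + 1))| := abs_nonneg _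
      rw [Real.rpow_neg hy0.le, ← div_eq_mul_inv, le_div_iff₀ hy8]
      exact mul_le_mul_of_nonneg_left hpow hh0
    calc |∑' m : ℕ, hloc n (m + (N + 1))| ≤ ∑' m : ℕ, |hloc n (m + (N + 1))| := by
          have := norm_tsum_le_tsum_norm (f := fun m : ℕ ↦ hloc n (m + (N + 1))) (by simpa [Real.norm_eq_abs] using hsa')
          simpa [Real.norm_eq_abs] using this
      _ ≤ ∑' m : ℕ, (|hloc n (m + (N + 1))| * ((m + (N + 1) : ℕ) : ℝ) ^ (1 / 8 : ℝ)) * y ^ (-(1 / 8 : ℝ)) :=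
          hsa'.tsum_le_tsum hpt (hsw'.mul_right _)
      _ = (∑' m : ℕ, |hloc n (m + (N + 1))| * ((m + (N + 1) : ℕ) : ℝ) ^ (1 / 8 : ℝ)) * y ^ (-(1 / 8 : ℝ)) := tsum_mul_right
      _ ≤ (C_h * D) * (C₈ / (1 + L) ^ 12) := mul_le_mul htail (h8 y hy) (by positivity) (by positivity)
      _ = C_h * C₈ * D / (1 + L) ^ 12 := by ring
  ------------------------------------------------------------
  -- assembly
  ------------------------------------------------------------
  have hDL : 0 ≤ D / (1 + L) ^ 12 := by positivity
  calc |2 * ∑ m ∈ Icc 1 N, hloc n m * (Nf m + 1) + ∑ m ∈ Icc 1 N, hloc n m * (Pt m * Mf m) +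
        2 * ∑' m : ℕ, hloc n (m + (N + 1))|
      ≤ |2 * ∑ m ∈ Icc 1 N, hloc n m * (Nf m + 1)| + |∑ m ∈ Icc 1 N, hloc n m * (Pt m * Mf m)| +
        |2 * ∑' m : ℕ, hloc n (m + (N + 1))| := abs_add_three _ _ _
    _ ≤ 2 * (K₄ * C_h * ((2 : ℝ) ^ 12 + C₁₆) * D / (1 + L) ^ 12) +
        2 ^ 10 * C_M * C_h * ((2 : ℝ) ^ 12 + C₃₂) * D / (1 + L) ^ 12 + 2 * (C_h * C₈ * D / (1 + L) ^ 12) := by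
        rw [abs_mul, abs_two, abs_mul, abs_two]
        exact add_le_add (add_le_add (mul_le_mul_of_nonneg_left ha zero_le_two) hb)
          (mul_le_mul_of_nonneg_left hc zero_le_two)
    _ = (2 * K₄ * C_h * ((2 : ℝ) ^ 12 + C₁₆) + 2 ^ 10 * C_M * C_h * ((2 : ℝ) ^ 12 + C₃₂) + 2 * C_h * C₈) *
        (D / (1 + L) ^ 12) := by ring
    _ ≤ C * (D / (1 + L) ^ 12) := by
        apply mul_le_mul_of_nonneg_right _ hDL
        rw [hCdef]; linarith [hC_h.le]
    _ = C * D / (1 + L) ^ 12 := by ring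

end Summit.Parity.GeneralizedHardyLittlewood.Theorems.MomentsBeyondDiagonal.DiagCorner

end
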